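import Literature.MathematicalPhysics.QuantumFieldTheory.Balaban1983to89.B9Eq34CovCurlVector

/-!
# `Balaban1983to89.B9Eq310DeltaPrime` — T. Bałaban, *Propagators for lattice gauge theories in a background field*, Commun. Math. Phys.
# **99** (1985) 389–434 [Balaban1985BackgroundPropagators], (3.1)–(3.2) p. 390, (3.4)–(3.7) p. 391, (3.10) p. 392: THE CURVATURE PART `Δ′` OF
# THE HESSIAN `Δ^η(U) = D*D + Δ′` — the plaquette holonomy `U(∂p)` with its «Re» and «Im» parts (p. 391, complexified reading), the
# transported edge variables `A′(b)`, `b ⊂ ∂(p)_z` (p. 390), the identity `(DA)(p) = η⁻¹ Σ_{b⊂∂(p)_z} A′(b)` ((3.4)), and the quadratic form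
# (3.10) `⟨A, Δ′A⟩` (with its polarization) as a genuine BILINEAR FORM on `𝔤ᶜ`-valued bond functions of the periodic lattice; `Δ′ ≡ 0` at
# the flat background («generalizing the operator ∂*∂ in the Abelian case»)

statement-level skeleton of published theorems with citation tags; proofs where landed; nothing here is a claim
about the Yang–Mills mass gap

PDF held: `paper:balaban1985-cmp99-background-propagators` (journal page = PDF page + 388); pp. 390–392 (PDF 2–4) READ AS IMAGES from the
renders `pub-balaban/b2b-balaban-ref1/pages/1985-cmp99-background-propagators/1985-cmp99-background-propagators-p002-x2.png`, `-p003-x2.png`,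
`-p004-x2.png`/`-p004-x4.png` by this seat (2026-08-21) — the held OCR text of (3.2), (3.6)–(3.7), (3.10) is garbled.

THE PRINT (verbatim from the renders).
* p. 390, (3.1): *«A^η(U′U₀) = Σ_{p⊂T_η} η^{d−4}[1 − Re tr(U′U₀)(∂p)], tr(U′U₀)(∂p) = tr(∂₀U′)((p)_z)U₀(∂p), where for a plaquette p = ⟨x, y, z, w⟩ we
  define (p)_z = ⟨z, w, x, y⟩, and (∂₀U′)((p)_z) = R(U₀(x, w))U′(z, w)U′(w, x)U′(x, y)R(U₀(x, y))U′(y, z). Let us recall that R(U)X = UXU⁻¹.»*;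
  (3.2): *«(∂₀U′)((p)_z) = 1 + iη Σ_{b⊂∂(p)_z} A′(b) − ½η²[Σ_{b⊂∂(p)_z}(A′(b))² + 2 Σ_{b₁,b₂⊂∂(p)_z, b₁≺b₂} A′(b₁)A′(b₂)] + …, where A′(b) are defined for
  bonds b ⊂ ∂(p)_z by the equalities A′(z, w) = R(U₀(x, w))A(z, w), A′(w, x) = A(w, x), A′(x, y) = A(x, y), A′(y, z) = R(U₀(x, y))·A(y, z), and ≺
  denotes a natural ordering among bonds of the oriented contour ∂(p)_z = ⟨z, w⟩ ∪ ⟨w, x⟩ ∪ ⟨x, y⟩ ∪ ⟨y, z⟩.»*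
* p. 391, (3.4): *«(D^η_{U₀}A)(p) = η⁻¹(A(x, y) + R(U₀(x, y))A(y, z) + R(U₀(x, w))A(z, w) + A(w, x)) for a plaquette p = ⟨x, y, z, w⟩, and if p =
  p_{μν}(x) = ⟨x, x + ηe_μ, x + ηe_μ + ηe_ν, x + ηe_ν⟩, then we have (D^η_{U₀}A)(p_{μν}(x)) = (D^η_{U₀,μ}A_ν)(x) − (D^η_{U₀,ν}A_μ)(x).»*; (3.5):
  *«U(x, x′) = U⁻¹(x′, x), A(x, x′) = −A(x′, x) for a bond ⟨x, x′⟩.»*; (3.7): *«A^η(U′U₀) = A^η(U₀) + Σ_p η^d tr(D^η_{U₀}A)(p)η⁻² Im U₀(∂p) +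
  ½ Σ_p η^d [tr((D^η_{U₀}A)(p))² Re U₀(∂p) + tr Σ_{b₁,b₂⊂∂(p)_z, b₁≺b₂} i[A′(b₁), A′(b₂)]η⁻² Im U₀(∂p)] + ⋯ = A^η(U₀) + ⟨D^η_{U₀}A, η⁻² Im ∂U₀⟩ +
  ½⟨A, Δ^η(U₀)A⟩ + ⋯. (3.7) This expansion is valid also for configurations A and U₀ with values respectively in the complexified algebra 𝔤ᶜ
  and the group Gᶜ, we have to interpret only Re U₀(∂p) and Im U₀(∂p) as Re U₀(∂p) = ½(U₀(∂p) + U₀(−∂p)), Im U₀(∂p) = (1/2i)(U₀(∂p) − U₀(−∂p)).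
  Here −∂p is the contour ∂(−p), and U₀(−∂p) = (U₀(∂p))⁻¹.»*
* p. 392, (3.10): *«⟨A, ΔA⟩ = ⟨A, D*DA⟩ + ⟨A, Δ′A⟩, ⟨A, Δ′A⟩ = Σ_{p⊂T_η} η^d tr((D¹_U A)(p))²η⁻²(Re U(∂p) − 1) + tr Σ_{b₁,b₂⊂∂(p)_z, b₁≺b₂}
  i[A′(b₁), A′(b₂)]η⁻² Im U(∂p). (3.10) We have written it this way because with our assumptions on the configuration U the operator Δ′ will be
  a bounded, small operator, which will be treated as a small perturbation of D*D.»*  READING: `(D¹_U A)(p) = Σ_{b⊂∂(p)_z} A′(b) = η·(D^η_U A)(p)`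
  (the unit-lattice derivative), so `tr((D¹_U A)(p))²η⁻² = tr((D^η_U A)(p))²` — consistent with (3.7), from which (3.10) is read off; the file
  states both terms with `D^η` (`curvForm_apply_self`).

WHY THIS FILE (cell context).  The pub-balaban NE9 owner's gen-76 file `B9Eq34CovCurlVector` typed (3.4) `D`, (3.9) `D*` and the PRINCIPAL
part `D*D` of `Δ` (*«(M4) NOT TYPED: the curvature part Δ′ of (3.10)»*).  The Hessian `Δ₁` is the first DATA letter of `G₁ = (Δ₁ + DRD* +
aQ*Q)⁻¹` (letters (L2)/(L6), `B11Eq110GreenInverse`/`B11Eq103H1Complex`); this file types its remaining part `Δ′` — the plaquette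
curvature terms — as an explicit symmetric bilinear form on the `𝔤ᶜ`-valued bond functions, built compositionally from linear maps (so
bilinearity is by construction), with the printed (3.10)/(3.7) shapes certified on the diagonal and `Δ′ = 0` at `U ≡ 1`.  The trace is a
linear DATUM `τ : 𝔸 →ₗ[ℂ] ℂ` (print: the normalized trace `tr`, p. 392); `Re`/`Im` of the holonomy are the complexified ones of p. 391.

WHAT IS DEFINED AND PROVED (sorry-free; no `Prop` placeholder; no inequality of the paper).
* §1 `plaqHolU U p` — `U(∂p) = U(x,y)U(y,z)U(z,w)U(w,x)` in `𝔸ˣ` ([B7] (9) order of factors = order of bonds; backward bonds inverted by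
  (3.5)); `plaqHolU_eq_plaqHol` (= the tree's `B8CurlGradHolonomy.plaqHol`, by `rfl`); `reHol`, `imHol` (p. 391) with `reHol_add_I_smul_imHol`
  (`Re U + i·Im U = U(∂p)`), `reHol_one`, `imHol_one` (flat background: `Re = 1`, `Im = 0`).
* §2 `edgeLin U p k` (`k : Fin 4`) — the four transported edge variables `A′(b)`, `b ⊂ ∂(p)_z`, in the order `≺` of `∂(p)_z = ⟨z,w⟩∪⟨w,x⟩∪⟨x,y⟩∪
  ⟨y,z⟩`, as LINEAR maps of `A` (values `−R(U_ν(x))A_μ(x+e_ν)`, `−A_ν(x)`, `A_μ(x)`, `R(U_μ(x))A_ν(x+e_μ)` at `p = p_{μν}(x)`, by (3.5));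
  `curlAt c U p` = `A ↦ (D_U A)(p)` (the gen-76 `covCurl c (adTransport U)` evaluated at `p`); **`curlAt_eq_smul_sum_edgeLin`** — (3.4)
  «`(DA)(p) = η⁻¹ Σ_{b⊂∂(p)_z} A′(b)`».
* §3 `trMul τ M` (`(X, Y) ↦ τ(XYM)`), `symTrMul`, `commTr` — the bilinear building blocks; **`curvForm η U τ`** : `(Bond → 𝔸) →ₗ[ℂ] (Bond → 𝔸)
  →ₗ[ℂ] ℂ` — THE POLARIZED (3.10): `Σ_p η^d [ τ(½{(DA)(p),(DB)(p)}·(Re U(∂p) − 1)) + τ(Σ_{b₁≺b₂} (i/2)([A′(b₁),B′(b₂)] + [B′(b₁),A′(b₂)])·η⁻² Im U(∂p)) ]`;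
  **`curvForm_apply_self`** — ON THE DIAGONAL IT IS (3.10) VERBATIM (with `D^η`): `⟨A, Δ′A⟩ = Σ_p η^d [τ((DA)(p)²(Re U(∂p) − 1)) + τ((Σ_{b₁≺b₂}
  i[A′(b₁), A′(b₂)])·η⁻² Im U(∂p))]`; `curvForm_symm`; **`curvForm_one`** (`Δ′ ≡ 0` at `U ≡ 1`).
* §4 `hessForm η U τ` := `Σ_p η^d τ((DA)(p)(DB)(p)) + curvForm` and **`hessForm_apply_self`** = the bracket of (3.7): `⟨A, ΔA⟩ = Σ_p η^d
  [τ((DA)(p)² Re U(∂p)) + τ((Σ_{b₁≺b₂} i[A′(b₁), A′(b₂)])·η⁻² Im U(∂p))]`; `hessForm_one` (flat: `Σ_p η^d τ((DA)(p)²)` — «∂*∂ in the Abelian case»).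
MODEL / DECLARED READINGS.  (M1) lattice/bond/plaquette conventions of `B9SectCLatticeCarrier` (positively oriented plaquettes `p_{μν}(x)`,
`μ < ν`; periodic); `𝔸 ⊇ 𝔤ᶜ` any complex algebra, `U` with values in its units, `τ` a linear datum (print: normalized trace); the scalar of
`D` spelled `((η : ℂ))⁻¹` (the cell's reference spelling, `B11Eq111FrakG.nabla115`).  (M2) complex-BILINEAR reading: for hermitian `A` and
unitary `U` print's `⟨A, Δ′A⟩` is the value of the form on the diagonal; the operator `Δ′` on the `L²` space (Riesz against `⟨X, Y⟩ = tr X*Y`)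
and its hermiticity are NOT constructed here (they need the compatibility of `τ` with the fibre's scalar product — next brick).  (M3) NOT
HERE: any bound («bounded, small operator»), the expansion (3.6)–(3.7) itself (the form is DEFINED by its printed second-order terms).
HONEST SCOPE.  Exact finite-dimensional lattice algebra realising printed FORMULAS as objects; no estimate of the paper; NOT summit progress
(cell pub-balaban: NE9 NOT PRINTED / NOT PROVED; spine PROVED 0/9).  Filed by the pub-balaban NE9 BINDER-row owner lineage
`b2b-balaban-t4-ne9-p1` (gen 77); a NEW file importing `B9Eq34CovCurlVector` only; nothing of lit-balaban's is modified.  Net new unproved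
facts: 0.
-/

noncomputable section

open scoped BigOperators

namespace Literature.MathematicalPhysics.QuantumFieldTheory.Balaban1983to89.B9Eq310DeltaPrime

open B9SectCLatticeCarrier (Bond Plaq DirPair bpos btgt shift)
open B4Sect5Torus (TSite)
open B9Eq33CovDerivVector (adTransport adTransport_apply)
open B9Eq34CovCurlVector (covCurl covCurl_adTransport_apply)

variable {d : ℕ} {Pd : Fin d → ℕ} {𝔸 : Type*} [Ring 𝔸]

/-! ## §1 The plaquette holonomy `U(∂p)` and its complexified real and imaginary parts (p. 391) -/

/-- **`U(∂p)`** for `p = p_{μν}(x) = ⟨x, x+e_μ, x+e_μ+e_ν, x+e_ν⟩`: the product over the oriented boundary `⟨x,y⟩∪⟨y,z⟩∪⟨z,w⟩∪⟨w,x⟩` in the order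
of the bonds ([B7] (9)), the two backward bonds contributing inverses by (3.5): `U_μ(x)·U_ν(x+e_μ)·U_μ(x+e_ν)⁻¹·U_ν(x)⁻¹`, in the units of `𝔸`.
[cite: Balaban1985BackgroundPropagators, (3.1) p.390, (3.5) p.391] -/
def plaqHolU (U : Bond d Pd → 𝔸ˣ) (p : Plaq d Pd) : 𝔸ˣ :=
  U (p.1, p.2.1.1) * U (shift p.2.1.1 p.1, p.2.1.2) * (U (shift p.2.1.2 p.1, p.2.1.1))⁻¹ * (U (p.1, p.2.1.2))⁻¹

/-- Consistency with the tree's one-plaquette holonomy `B8CurlGradHolonomy.plaqHol` (same ordering convention), by `rfl`.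
[cite: Balaban1985BackgroundPropagators, (3.1) p.390] -/
theorem plaqHolU_eq_plaqHol (U : Bond d Pd → 𝔸ˣ) (x : TSite d Pd) (q : DirPair d) :
    plaqHolU U (x, q) = B8CurlGradHolonomy.plaqHol (shift q.1.1) (shift q.1.2) (fun y => U (y, q.1.1)) (fun y => U (y, q.1.2)) x := rfl

/-- The trivial configuration has trivial holonomy. [cite: Balaban1985BackgroundPropagators, (3.1) p.390] -/
@[simp] theorem plaqHolU_one (p : Plaq d Pd) : plaqHolU (fun _ : Bond d Pd => (1 : 𝔸ˣ)) p = 1 := by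
  simp [plaqHolU]

variable [Algebra ℂ 𝔸]

/-- **`Re U(∂p) = ½(U(∂p) + U(−∂p))`**, `U(−∂p) = U(∂p)⁻¹` — the complexified real part of p. 391. [cite: Balaban1985BackgroundPropagators, (3.7) p.391] -/
def reHol (U : Bond d Pd → 𝔸ˣ) (p : Plaq d Pd) : 𝔸 := (1 / 2 : ℂ) • ((plaqHolU U p : 𝔸) + ((plaqHolU U p)⁻¹ : 𝔸ˣ))

/-- **`Im U(∂p) = (1/2i)(U(∂p) − U(−∂p))`** — the complexified imaginary part of p. 391 (`1/(2i) = −i/2`). [cite: Balaban1985BackgroundPropagators, (3.7) p.391] -/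
def imHol (U : Bond d Pd → 𝔸ˣ) (p : Plaq d Pd) : 𝔸 := (-Complex.I / 2) • ((plaqHolU U p : 𝔸) - ((plaqHolU U p)⁻¹ : 𝔸ˣ))

/-- `Re U(∂p) + i·Im U(∂p) = U(∂p)`. [cite: Balaban1985BackgroundPropagators, (3.7) p.391] -/
theorem reHol_add_I_smul_imHol (U : Bond d Pd → 𝔸ˣ) (p : Plaq d Pd) : reHol U p + Complex.I • imHol U p = (plaqHolU U p : 𝔸) := by
  rw [reHol, imHol, smul_smul, show Complex.I * (-Complex.I / 2) = (1 / 2 : ℂ) by rw [mul_div_assoc', mul_neg, Complex.I_mul_I, neg_neg],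
    ← smul_add, add_add_sub_cancel, ← two_smul ℂ, smul_smul]
  norm_num

/-- At the flat background `Re U(∂p) = 1`. [cite: Balaban1985BackgroundPropagators, (3.7) p.391] -/
@[simp] theorem reHol_one (p : Plaq d Pd) : reHol (fun _ : Bond d Pd => (1 : 𝔸ˣ)) p = 1 := by
  rw [reHol, plaqHolU_one, inv_one, Units.val_one, ← two_smul ℂ, smul_smul]
  norm_num

/-- At the flat background `Im U(∂p) = 0`. [cite: Balaban1985BackgroundPropagators, (3.7) p.391] -/
@[simp] theorem imHol_one (p : Plaq d Pd) : imHol (fun _ : Bond d Pd => (1 : 𝔸ˣ)) p = 0 := by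
  rw [imHol, plaqHolU_one, inv_one, sub_self, smul_zero]

/-! ## §2 The transported edge variables `A′(b)`, `b ⊂ ∂(p)_z` (p. 390), and (3.4) as their sum -/

/-- **The four transported edge variables `A′(b)` of p. 390**, indexed by the position of `b` in the oriented contour
`∂(p)_z = ⟨z,w⟩ ∪ ⟨w,x⟩ ∪ ⟨x,y⟩ ∪ ⟨y,z⟩` (the «natural ordering ≺»), for `p = p_{μν}(x)` (`y = x+e_μ`, `z = x+e_μ+e_ν`, `w = x+e_ν`), with the
antisymmetry (3.5) `A(x, x′) = −A(x′, x)` used to express them through the positively oriented components `A_μ(x) = A(x, x+e_μ)`: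
`A′(z,w) = R(U(x,w))A(z,w) = −R(U_ν(x))A_μ(x+e_ν)`, `A′(w,x) = A(w,x) = −A_ν(x)`, `A′(x,y) = A_μ(x)`, `A′(y,z) = R(U(x,y))A(y,z) = R(U_μ(x))A_ν(x+e_μ)`
— each a LINEAR map of `A`. [cite: Balaban1985BackgroundPropagators, (3.2) p.390, (3.5) p.391] -/
def edgeLin (U : Bond d Pd → 𝔸ˣ) (p : Plaq d Pd) : Fin 4 → ((Bond d Pd → 𝔸) →ₗ[ℂ] 𝔸) :=
  ![-(adTransport (𝕜 := ℂ) U (p.1, p.2.1.2) ∘ₗ LinearMap.proj (shift p.2.1.2 p.1, p.2.1.1)),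
    -(LinearMap.proj (p.1, p.2.1.2)),
    LinearMap.proj (p.1, p.2.1.1),
    adTransport (𝕜 := ℂ) U (p.1, p.2.1.1) ∘ₗ LinearMap.proj (shift p.2.1.1 p.1, p.2.1.2)]

/-- `A′(z,w) = −U_ν(x)·A_μ(x+e_ν)·U_ν(x)⁻¹`. [cite: Balaban1985BackgroundPropagators, (3.2) p.390] -/
theorem edgeLin_zero (U : Bond d Pd → 𝔸ˣ) (x : TSite d Pd) (q : DirPair d) (A : Bond d Pd → 𝔸) :
    edgeLin U (x, q) 0 A = -((U (x, q.1.2) : 𝔸) * A (shift q.1.2 x, q.1.1) * ((U (x, q.1.2))⁻¹ : 𝔸ˣ)) := by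
  simp [edgeLin, adTransport_apply]

/-- `A′(w,x) = −A_ν(x)`. [cite: Balaban1985BackgroundPropagators, (3.2) p.390] -/
theorem edgeLin_one (U : Bond d Pd → 𝔸ˣ) (x : TSite d Pd) (q : DirPair d) (A : Bond d Pd → 𝔸) :
    edgeLin U (x, q) 1 A = -A (x, q.1.2) := by
  simp [edgeLin]

/-- `A′(x,y) = A_μ(x)`. [cite: Balaban1985BackgroundPropagators, (3.2) p.390] -/
theorem edgeLin_two (U : Bond d Pd → 𝔸ˣ) (x : TSite d Pd) (q : DirPair d) (A : Bond d Pd → 𝔸) :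
    edgeLin U (x, q) 2 A = A (x, q.1.1) := by
  simp [edgeLin]

/-- `A′(y,z) = U_μ(x)·A_ν(x+e_μ)·U_μ(x)⁻¹`. [cite: Balaban1985BackgroundPropagators, (3.2) p.390] -/
theorem edgeLin_three (U : Bond d Pd → 𝔸ˣ) (x : TSite d Pd) (q : DirPair d) (A : Bond d Pd → 𝔸) :
    edgeLin U (x, q) 3 A = (U (x, q.1.1) : 𝔸) * A (shift q.1.1 x, q.1.2) * ((U (x, q.1.1))⁻¹ : 𝔸ˣ) := by
  simp [edgeLin, adTransport_apply]

/-- **`(D_U A)(p)` as a linear functional of `A`** (the covariant curl (3.4) of `B9Eq34CovCurlVector` with the transporter `R(U)X = UXU⁻¹`,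
evaluated at the plaquette `p`; scalar `c = η⁻¹`). [cite: Balaban1985BackgroundPropagators, (3.4) p.391] -/
def curlAt (c : ℂ) (U : Bond d Pd → 𝔸ˣ) (p : Plaq d Pd) : (Bond d Pd → 𝔸) →ₗ[ℂ] 𝔸 :=
  LinearMap.proj p ∘ₗ covCurl c (adTransport (𝕜 := ℂ) U)

/-- Unfolding: `curlAt c U p A = (covCurl c (adTransport U) A)(p)`. [cite: Balaban1985BackgroundPropagators, (3.4) p.391] -/
@[simp] theorem curlAt_apply (c : ℂ) (U : Bond d Pd → 𝔸ˣ) (p : Plaq d Pd) (A : Bond d Pd → 𝔸) :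
    curlAt c U p A = covCurl c (adTransport (𝕜 := ℂ) U) A p := rfl

/-- **(3.4), first form: `(D^η_U A)(p) = η⁻¹ Σ_{b⊂∂(p)_z} A′(b)`** — the curl at `p` is `c` times the sum of the four transported edge variables.
[cite: Balaban1985BackgroundPropagators, (3.4) p.391, (3.2) p.390] -/
theorem curlAt_eq_smul_sum_edgeLin (c : ℂ) (U : Bond d Pd → 𝔸ˣ) (p : Plaq d Pd) (A : Bond d Pd → 𝔸) :
    curlAt c U p A = c • ∑ k : Fin 4, edgeLin U p k A := by
  obtain ⟨x, q⟩ := p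
  rw [curlAt_apply, covCurl_adTransport_apply, Fin.sum_univ_four, edgeLin_zero, edgeLin_one, edgeLin_two, edgeLin_three, ← smul_sub]
  congr 1
  abel

/-! ## §3 The curvature form (3.10) `⟨A, Δ′A⟩`, polarized, as a bilinear form -/

section Form

variable (τ : 𝔸 →ₗ[ℂ] ℂ)

/-- The bilinear building block `(X, Y) ↦ τ(X·Y·M)` for a fixed matrix `M` (`tr` against `Re U(∂p) − 1` or `η⁻² Im U(∂p)`).
[cite: Balaban1985BackgroundPropagators, (3.7) p.391, (3.10) p.392] -/
def trMul (M : 𝔸) : 𝔸 →ₗ[ℂ] 𝔸 →ₗ[ℂ] ℂ :=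
  (LinearMap.mul ℂ 𝔸).compr₂ (τ ∘ₗ LinearMap.mulRight ℂ M)

/-- Unfolding: `trMul τ M X Y = τ (X * Y * M)`. [cite: Balaban1985BackgroundPropagators, (3.10) p.392] -/
@[simp] theorem trMul_apply (M X Y : 𝔸) : trMul τ M X Y = τ (X * Y * M) := rfl

/-- The symmetrized block `(X, Y) ↦ τ(½(XY + YX)·M)` (polarization of `tr(X²M)`). [cite: Balaban1985BackgroundPropagators, (3.10) p.392] -/
def symTrMul (M : 𝔸) : 𝔸 →ₗ[ℂ] 𝔸 →ₗ[ℂ] ℂ := (1 / 2 : ℂ) • (trMul τ M + (trMul τ M).flip)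

/-- Unfolding: `symTrMul τ M X Y = ½(τ(XYM) + τ(YXM))`. [cite: Balaban1985BackgroundPropagators, (3.10) p.392] -/
theorem symTrMul_apply (M X Y : 𝔸) : symTrMul τ M X Y = (1 / 2 : ℂ) * (τ (X * Y * M) + τ (Y * X * M)) := by
  simp [symTrMul, mul_add]

/-- The commutator block `(X, Y) ↦ τ([X, Y]·M)` (`[X, Y] = XY − YX`). [cite: Balaban1985BackgroundPropagators, (3.10) p.392] -/
def commTr (M : 𝔸) : 𝔸 →ₗ[ℂ] 𝔸 →ₗ[ℂ] ℂ := trMul τ M - (trMul τ M).flip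

/-- Unfolding: `commTr τ M X Y = τ((XY − YX)·M)`. [cite: Balaban1985BackgroundPropagators, (3.10) p.392] -/
theorem commTr_apply (M X Y : 𝔸) : commTr τ M X Y = τ ((X * Y - Y * X) * M) := by
  simp [commTr, sub_mul]

/-- The ordered pairs `b₁ ≺ b₂` of edges of `∂(p)_z` (`k < l` in `Fin 4`). [cite: Balaban1985BackgroundPropagators, (3.2) p.390] -/
def orderedPairs : Finset (Fin 4 × Fin 4) := Finset.univ.filter fun kl => kl.1 < kl.2

/-- Membership in the ordered pairs. [cite: Balaban1985BackgroundPropagators, (3.2) p.390] -/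
@[simp] theorem mem_orderedPairs (kl : Fin 4 × Fin 4) : kl ∈ orderedPairs ↔ kl.1 < kl.2 := by
  simp [orderedPairs]

/-- **The first (field-strength) block of (3.10) at one plaquette, polarized**: `(A, B) ↦ τ(½{(DA)(p), (DB)(p)}·(Re U(∂p) − 1))`.
[cite: Balaban1985BackgroundPropagators, (3.10) p.392] -/
def curvBlock₁ (η : ℝ) (U : Bond d Pd → 𝔸ˣ) (p : Plaq d Pd) : (Bond d Pd → 𝔸) →ₗ[ℂ] (Bond d Pd → 𝔸) →ₗ[ℂ] ℂ :=
  (symTrMul τ (reHol U p - 1)).compl₁₂ (curlAt ((η : ℂ))⁻¹ U p) (curlAt ((η : ℂ))⁻¹ U p)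

/-- Unfolding the first block. [cite: Balaban1985BackgroundPropagators, (3.10) p.392] -/
theorem curvBlock₁_apply (η : ℝ) (U : Bond d Pd → 𝔸ˣ) (p : Plaq d Pd) (A B : Bond d Pd → 𝔸) :
    curvBlock₁ τ η U p A B =
      (1 / 2 : ℂ) * (τ (curlAt ((η : ℂ))⁻¹ U p A * curlAt ((η : ℂ))⁻¹ U p B * (reHol U p - 1)) +
        τ (curlAt ((η : ℂ))⁻¹ U p B * curlAt ((η : ℂ))⁻¹ U p A * (reHol U p - 1))) := by
  rw [curvBlock₁, LinearMap.compl₁₂_apply, symTrMul_apply]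

/-- **The second (commutator) block of (3.10) at one plaquette, polarized**: `(A, B) ↦ Σ_{b₁≺b₂} (i/2)·τ(([A′(b₁), B′(b₂)] + [B′(b₁), A′(b₂)])·
η⁻² Im U(∂p))`. [cite: Balaban1985BackgroundPropagators, (3.10) p.392] -/
def curvBlock₂ (η : ℝ) (U : Bond d Pd → 𝔸ˣ) (p : Plaq d Pd) : (Bond d Pd → 𝔸) →ₗ[ℂ] (Bond d Pd → 𝔸) →ₗ[ℂ] ℂ :=
  ∑ kl ∈ orderedPairs,
    (Complex.I / 2) •
      ((commTr τ ((((η : ℂ))⁻¹) ^ 2 • imHol U p)).compl₁₂ (edgeLin U p kl.1) (edgeLin U p kl.2) +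
        ((commTr τ ((((η : ℂ))⁻¹) ^ 2 • imHol U p)).compl₁₂ (edgeLin U p kl.1) (edgeLin U p kl.2)).flip)

/-- Unfolding the second block. [cite: Balaban1985BackgroundPropagators, (3.10) p.392] -/
theorem curvBlock₂_apply (η : ℝ) (U : Bond d Pd → 𝔸ˣ) (p : Plaq d Pd) (A B : Bond d Pd → 𝔸) :
    curvBlock₂ τ η U p A B =
      ∑ kl ∈ orderedPairs, Complex.I / 2 *
        (τ ((edgeLin U p kl.1 A * edgeLin U p kl.2 B - edgeLin U p kl.2 B * edgeLin U p kl.1 A) * ((((η : ℂ))⁻¹) ^ 2 • imHol U p)) +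
          τ ((edgeLin U p kl.1 B * edgeLin U p kl.2 A - edgeLin U p kl.2 A * edgeLin U p kl.1 B) * ((((η : ℂ))⁻¹) ^ 2 • imHol U p))) := by
  simp only [curvBlock₂, LinearMap.coe_sum, Finset.sum_apply, LinearMap.smul_apply, LinearMap.add_apply, LinearMap.compl₁₂_apply,
    LinearMap.flip_apply, commTr_apply, smul_eq_mul]

/-- **THE CURVATURE FORM (3.10), POLARIZED: `curvForm η U τ A B`** — the symmetric bilinear form on `𝔤ᶜ`-valued bond functions whose diagonal
is print's `⟨A, Δ′A⟩` (`curvForm_apply_self`): `Σ_{p⊂T_η} η^d [ τ(½{(DA)(p),(DB)(p)}(Re U(∂p) − 1)) + Σ_{b₁≺b₂} (i/2)τ(([A′(b₁),B′(b₂)] +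
[B′(b₁),A′(b₂)])η⁻² Im U(∂p)) ]`. [cite: Balaban1985BackgroundPropagators, (3.10) p.392] -/
def curvForm (η : ℝ) (U : Bond d Pd → 𝔸ˣ) : (Bond d Pd → 𝔸) →ₗ[ℂ] (Bond d Pd → 𝔸) →ₗ[ℂ] ℂ :=
  ∑ p : Plaq d Pd, ((η : ℂ)) ^ d • (curvBlock₁ τ η U p + curvBlock₂ τ η U p)

/-- Unfolding the curvature form plaquette by plaquette. [cite: Balaban1985BackgroundPropagators, (3.10) p.392] -/
theorem curvForm_apply (η : ℝ) (U : Bond d Pd → 𝔸ˣ) (A B : Bond d Pd → 𝔸) :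
    curvForm τ η U A B = ∑ p : Plaq d Pd, ((η : ℂ)) ^ d * (curvBlock₁ τ η U p A B + curvBlock₂ τ η U p A B) := by
  simp only [curvForm, LinearMap.coe_sum, Finset.sum_apply, LinearMap.smul_apply, LinearMap.add_apply, smul_eq_mul]

/-- **ON THE DIAGONAL THE FORM IS (3.10) VERBATIM** (with `D¹ = ηD^η`, i.e. `tr((D¹A)(p))²η⁻² = tr((D^ηA)(p))²`):
`⟨A, Δ′A⟩ = Σ_{p⊂T_η} η^d [ tr((D^η_U A)(p))²(Re U(∂p) − 1) + tr (Σ_{b₁,b₂⊂∂(p)_z, b₁≺b₂} i[A′(b₁), A′(b₂)]) η⁻² Im U(∂p) ]`.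
[cite: Balaban1985BackgroundPropagators, (3.10) p.392] -/
theorem curvForm_apply_self (η : ℝ) (U : Bond d Pd → 𝔸ˣ) (A : Bond d Pd → 𝔸) :
    curvForm τ η U A A =
      ∑ p : Plaq d Pd, ((η : ℂ)) ^ d *
        (τ (curlAt ((η : ℂ))⁻¹ U p A * curlAt ((η : ℂ))⁻¹ U p A * (reHol U p - 1)) +
          τ ((∑ kl ∈ orderedPairs, Complex.I • (edgeLin U p kl.1 A * edgeLin U p kl.2 A - edgeLin U p kl.2 A * edgeLin U p kl.1 A)) *
            ((((η : ℂ))⁻¹) ^ 2 • imHol U p))) := by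
  rw [curvForm_apply]
  refine Finset.sum_congr rfl fun p _ => ?_
  congr 1
  rw [curvBlock₁_apply, curvBlock₂_apply, Finset.sum_mul, map_sum]
  congr 1
  · ring
  · refine Finset.sum_congr rfl fun kl _ => ?_
    rw [smul_mul_assoc, map_smul, smul_eq_mul]
    ring

/-- **The curvature form is symmetric** (it is a polarization). [cite: Balaban1985BackgroundPropagators, (3.10) p.392] -/
theorem curvForm_symm (η : ℝ) (U : Bond d Pd → 𝔸ˣ) (A B : Bond d Pd → 𝔸) : curvForm τ η U A B = curvForm τ η U B A := by
  rw [curvForm_apply, curvForm_apply]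
  refine Finset.sum_congr rfl fun p _ => ?_
  congr 1
  rw [curvBlock₁_apply, curvBlock₁_apply, curvBlock₂_apply, curvBlock₂_apply, add_comm (τ _) (τ _)]
  congr 1
  exact Finset.sum_congr rfl fun kl _ => by rw [add_comm (τ _) (τ _)]

/-- **`Δ′ ≡ 0` AT THE FLAT BACKGROUND** (`U ≡ 1`: `Re U(∂p) − 1 = 0`, `Im U(∂p) = 0`) — then `Δ = D*D`, «the operator ∂*∂ in the Abelian case».
[cite: Balaban1985BackgroundPropagators, (3.10) p.392] -/
theorem curvForm_one (η : ℝ) (A B : Bond d Pd → 𝔸) : curvForm τ η (fun _ : Bond d Pd => (1 : 𝔸ˣ)) A B = 0 := by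
  rw [curvForm_apply]
  refine Finset.sum_eq_zero fun p _ => ?_
  rw [curvBlock₁_apply, curvBlock₂_apply, reHol_one, imHol_one, sub_self, mul_zero, mul_zero, map_zero, add_zero, mul_zero, zero_add,
    smul_zero]
  simp

end Form

/-! ## §4 The full Hessian form of (3.7)/(3.10): `⟨A, ΔA⟩ = ⟨A, D*DA⟩ + ⟨A, Δ′A⟩` read with `τ` -/

section Hess

variable (τ : 𝔸 →ₗ[ℂ] ℂ)

/-- The principal block `(A, B) ↦ τ((DA)(p)(DB)(p))` at one plaquette (the `τ`-bilinear reading of `|(DA)(p)|²`; `B9Eq34CovCurlVector.covLapPrincipal`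
is its operator `D*D`). [cite: Balaban1985BackgroundPropagators, (3.10) p.392] -/
def principalBlock (η : ℝ) (U : Bond d Pd → 𝔸ˣ) (p : Plaq d Pd) : (Bond d Pd → 𝔸) →ₗ[ℂ] (Bond d Pd → 𝔸) →ₗ[ℂ] ℂ :=
  (trMul τ 1).compl₁₂ (curlAt ((η : ℂ))⁻¹ U p) (curlAt ((η : ℂ))⁻¹ U p)

/-- Unfolding the principal block. [cite: Balaban1985BackgroundPropagators, (3.10) p.392] -/
theorem principalBlock_apply (η : ℝ) (U : Bond d Pd → 𝔸ˣ) (p : Plaq d Pd) (A B : Bond d Pd → 𝔸) :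
    principalBlock τ η U p A B = τ (curlAt ((η : ℂ))⁻¹ U p A * curlAt ((η : ℂ))⁻¹ U p B) := by
  rw [principalBlock, LinearMap.compl₁₂_apply, trMul_apply, mul_one]

/-- **THE HESSIAN FORM `⟨A, ΔB⟩ = Σ_p η^d τ((DA)(p)(DB)(p)) + ⟨A, Δ′B⟩`** — (3.10)'s `⟨A, D*DA⟩ + ⟨A, Δ′A⟩`, polarized, in the `τ`-bilinear reading.
[cite: Balaban1985BackgroundPropagators, (3.10) p.392, (3.7) p.391] -/
def hessForm (η : ℝ) (U : Bond d Pd → 𝔸ˣ) : (Bond d Pd → 𝔸) →ₗ[ℂ] (Bond d Pd → 𝔸) →ₗ[ℂ] ℂ :=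
  (∑ p : Plaq d Pd, ((η : ℂ)) ^ d • principalBlock τ η U p) + curvForm τ η U

/-- Unfolding the Hessian form. [cite: Balaban1985BackgroundPropagators, (3.10) p.392] -/
theorem hessForm_apply (η : ℝ) (U : Bond d Pd → 𝔸ˣ) (A B : Bond d Pd → 𝔸) :
    hessForm τ η U A B = (∑ p : Plaq d Pd, ((η : ℂ)) ^ d * τ (curlAt ((η : ℂ))⁻¹ U p A * curlAt ((η : ℂ))⁻¹ U p B)) + curvForm τ η U A B := by
  simp only [hessForm, LinearMap.add_apply, LinearMap.coe_sum, Finset.sum_apply, LinearMap.smul_apply, principalBlock_apply, smul_eq_mul]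

/-- **ON THE DIAGONAL THE HESSIAN FORM IS THE BRACKET OF (3.7)**: `⟨A, Δ^η(U)A⟩ = Σ_p η^d [ tr((D^η_U A)(p))² Re U(∂p) + tr (Σ_{b₁≺b₂} i[A′(b₁),
A′(b₂)]) η⁻² Im U(∂p) ]` (the `−1` of `Δ′` and the principal part recombine). [cite: Balaban1985BackgroundPropagators, (3.7) p.391, (3.10) p.392] -/
theorem hessForm_apply_self (η : ℝ) (U : Bond d Pd → 𝔸ˣ) (A : Bond d Pd → 𝔸) :
    hessForm τ η U A A =
      ∑ p : Plaq d Pd, ((η : ℂ)) ^ d *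
        (τ (curlAt ((η : ℂ))⁻¹ U p A * curlAt ((η : ℂ))⁻¹ U p A * reHol U p) +
          τ ((∑ kl ∈ orderedPairs, Complex.I • (edgeLin U p kl.1 A * edgeLin U p kl.2 A - edgeLin U p kl.2 A * edgeLin U p kl.1 A)) *
            ((((η : ℂ))⁻¹) ^ 2 • imHol U p))) := by
  rw [hessForm_apply, curvForm_apply_self, ← Finset.sum_add_distrib]
  refine Finset.sum_congr rfl fun p _ => ?_
  rw [← mul_add, ← add_assoc, ← map_add, mul_sub, mul_one, add_sub_cancel]

/-- **At the flat background the Hessian form is the principal one**: `⟨A, ΔB⟩ = Σ_p η^d τ((DA)(p)(DB)(p))` — «∂*∂ in the Abelian case».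
[cite: Balaban1985BackgroundPropagators, (3.10) p.392] -/
theorem hessForm_one (η : ℝ) (A B : Bond d Pd → 𝔸) :
    hessForm τ η (fun _ : Bond d Pd => (1 : 𝔸ˣ)) A B =
      ∑ p : Plaq d Pd, ((η : ℂ)) ^ d *
        τ (curlAt ((η : ℂ))⁻¹ (fun _ : Bond d Pd => (1 : 𝔸ˣ)) p A * curlAt ((η : ℂ))⁻¹ (fun _ : Bond d Pd => (1 : 𝔸ˣ)) p B) := by
  rw [hessForm_apply, curvForm_one, add_zero]

end Hess

end Literature.MathematicalPhysics.QuantumFieldTheory.Balaban1983to89.B9Eq310DeltaPrime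

end
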